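import Literature.AlgebraicGeometry.Modules.PushforwardTrace
import Literature.AlgebraicGeometry.KTheory.PullbackVectorBundle
import HarnessLib

/-!
# The transpose of the algebra unit `f♯ : 𝒪_Y → f_*𝒪_X` is the canonical isomorphism `f^*𝒪_Y ≅ 𝒪_X`

The Stacks Project, Tag 01AK / Hartshorne II.5 (p. 110): for a morphism of ringed spaces `f : X → Y` one has `f^*𝒪_Y = 𝒪_X`;
under the adjunction `f^* ⊣ f_*` (Mathlib `Scheme.Modules.pullbackPushforwardAdjunction`) the canonical isomorphism
`f^*𝒪_Y ⟶ 𝒪_X` is the TRANSPOSE of the algebra unit `f♯ : 𝒪_Y ⟶ f_*𝒪_X` (tree `Modules.PushforwardTrace.algebraUnit`,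
Stacks Tag 0BVH): `f^*(f♯) ≫ ε_{𝒪_X}`. This file proves that this composite IS Mathlib's `SheafOfModules.pullbackObjUnitToUnit`
and is therefore an ISOMORPHISM (Mathlib's instance, applicable because `U ↦ f⁻¹U` is final — tree
`KTheory.PullbackVectorBundle.final_opensMap`):

* `algebraUnit_eq_unitToPushforwardObjUnit` — the tree's `algebraUnit f` is Mathlib's `unitToPushforwardObjUnit` (same sections
  `f.app`);
* `pullback_map_algebraUnit_comp_counit` — `f^*(f♯) ≫ ε_{𝒪_X} = pullbackObjUnitToUnit` (`Adjunction.homEquiv_counit`);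
* `isIso_pullback_map_algebraUnit_comp_counit` — **it is an isomorphism**.

Motivation: the Gysin identity `ρ_q ∘ g^♮ = deg g` of the trace input (Tr) on crux stmt-HodgeConjecture-26512 (core-w1's R3-free
design of (G1): the class `[Q (f^*η ≫ ε)⁻¹]`); nothing of that crux is asserted here. Everything is proved; no named facts.
Mathlib searched (pin v4.32): `SheafOfModules.unitToPushforwardObjUnit`, `pullbackObjUnitToUnit`,
`pullbackPushforwardAdjunction_homEquiv_symm_unitToPushforwardObjUnit`, `instance [F.Final] : IsIso (pullbackObjUnitToUnit φ)`,
`Adjunction.homEquiv_counit` (all used).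

## References

* The Stacks Project, Tag 01AK (Sheaves of modules, `f^*𝒪_Y = 𝒪_X`), Tag 0BVH (the algebra unit and trace of a finite locally
  free morphism). [StacksProject]
* R. Hartshorne, *Algebraic Geometry*, GTM 52 (1977), II.5 p. 110 (`f^*`, `f_*`, adjunction). [Hartshorne1977]
-/

noncomputable section

open CategoryTheory AlgebraicGeometry
open AlgebraicGeometry.Scheme.Modules

universe u

namespace Literature.AlgebraicGeometry.Modules

variable {X Y : Scheme.{u}} (f : X ⟶ Y)

/-- The tree's algebra unit `f♯ : 𝒪_Y ⟶ f_*𝒪_X` (`algebraUnit`, sections `f.app`) is Mathlib's `unitToPushforwardObjUnit` for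
`f.toRingCatSheafHom`. [cite: StacksProject, Tag 0BVH (the map `𝒪_Y → π_*𝒪_X`)] -/
theorem algebraUnit_eq_unitToPushforwardObjUnit :
    algebraUnit f = SheafOfModules.unitToPushforwardObjUnit f.toRingCatSheafHom :=
  Scheme.Modules.hom_ext _ _ fun U => AddCommGrpCat.ext fun (_ : Γ(Y, U)) => rfl

/-- **`f^*(f♯) ≫ ε_{𝒪_X}` is the canonical map `f^*𝒪_Y ⟶ 𝒪_X`** (Mathlib `pullbackObjUnitToUnit` = the transpose of the unit under
`f^* ⊣ f_*`, `Adjunction.homEquiv_counit`). [cite: StacksProject, Tag 01AK (`f^*𝒪_Y = 𝒪_X`)] -/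
theorem pullback_map_algebraUnit_comp_counit :
    (pullback f).map (algebraUnit f) ≫ (pullbackPushforwardAdjunction f).counit.app (unitModule X) =
      SheafOfModules.pullbackObjUnitToUnit f.toRingCatSheafHom := by
  rw [algebraUnit_eq_unitToPushforwardObjUnit]
  exact ((pullbackPushforwardAdjunction f).homEquiv_counit _ _ _).symm

/-- **`f^*(f♯) ≫ ε_{𝒪_X} : f^*𝒪_Y ⟶ 𝒪_X` is an isomorphism** (`f^*𝒪_Y = 𝒪_X`; Mathlib's instance for `pullbackObjUnitToUnit`,
the functor `U ↦ f⁻¹U` being final, `final_opensMap`). [cite: StacksProject, Tag 01AK (`f^*𝒪_Y = 𝒪_X`)]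
[cite: Hartshorne1977, II.5 p. 110] -/
theorem isIso_pullback_map_algebraUnit_comp_counit :
    IsIso ((pullback f).map (algebraUnit f) ≫ (pullbackPushforwardAdjunction f).counit.app (unitModule X)) := by
  rw [pullback_map_algebraUnit_comp_counit]
  haveI := Literature.AlgebraicGeometry.KTheory.final_opensMap f
  exact SheafOfModules.instIsIsoPullbackObjUnitToUnitOfFinal _

end Literature.AlgebraicGeometry.Modules

end
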